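import Summits.ResolutionOfSingularities.ResolutionOfSingularities.Theorems.FrobeniusLadderFInjectiveMacaulayficationTrOfResolutionFull
import Mathlib.Algebra.MvPolynomial.Equiv
import HarnessLib

/-!
# THE ROUTE'S OWN RUNGS ONE DIMENSION DOWN, TAKEN ADMISSIBLY: door v38's resolution stub ⟸ F-half ∧ `FRationalModificationAdm` ∧ `FRationalResolutionAdm`
# (crux `FInjectiveMacaulayfication` stmt-ResolutionOfSingularities-15315, chain w45a; res-L1-w45a-plan-1 RULINGS R18.2 (1)(c) / R18.3 «ROUTE-INDUCTION READING»,
# object O2″; res-L1-w45a-tri-2 costume-read conditions (1)–(4) 07:38:03Z; seat res-L1-w45a-stub-3 g9, over `TrOfResolutionFull` p613542)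

[OURS · L1 W4.5a] Support file (`--supports stmt-ResolutionOfSingularities-15315 --as helper`); replaces the role of NO printed item; NOT a statement of
any manuscript; ONE abbreviation (`FRatCl`, the per-stalk F-rational clause of route items stmt-…-15316/15317 VERBATIM, reducible) and TWO definitions
(`@[conjecture] def FRationalModificationAdm`, `@[conjecture] def FRationalResolutionAdm` — OURS candidates, plain hypotheses, NOT route items; no route verb is
implied) + theorems CONDITIONAL on four published theorems BY NAME and on the chain's CANDIDATE statements. AI-written (AI review is weaker than expert review).

WHAT. The route `FrobeniusLadder` climbs #2 `FInjectiveMacaulayfication` (a FULL model) → #3 `FRationalModification` (an F-rational model of a scheme with a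
FULL model) → #4 `FRationalResolution` (resolution of a scheme with an F-rational model). Items #3/#4 AS TYPED are WEAK ∃-models («∃ proper birational π»):
they do NOT suffice here, because composing modifications into ONE `Sing X`-supported blowing up (Temkin Lemma 2.1.4 = Stacks 080B,
`IsBlowup.exists_isBlowup_comp_supported`) needs the second centre to lie over `Sing X`, i.e. the first modification to be an isomorphism over `Reg X` — a weak
F-rational model / weak resolution need not be, and no upgrade «weak ⇒ Reg-admissible» is known in dimension ≥ 3 (this is exactly where the summit's weak
`HasResolution` and Temkin's admissible `AdmitsDesingularization` part ways — R18.3 consequence (2)). Hence the ADMISSIBLE forms, typed Theorems-side with the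
items' quantifier prefix (`IsSeparated f → LocallyOfFiniteType f → QuasiCompact f → IsReduced X`), support bound `(Scheme.regularLocus X)ᶜ` THROUGHOUT (never
«non-FULL locus» / «non-F-rational locus»: F-rationalification must touch FULL-non-F-rational points, resolution must touch F-rational singular points):
* `FRationalModificationAdm` — INPUT: every stalk FULL (`SliceableCentre.FullCl p` = crux #2's per-stalk output package verbatim: domain ∧ s.o.p. weakly regular ∧
  parameter ideals Frobenius-closed); OUTPUT: ONE blowing up `X′ → X` along `J ≠ ⊥` with `Supp J ⊆ (Reg X)ᶜ` and every stalk of `X′` F-rational (`FRatCl p` =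
  item #3's per-stalk output verbatim: domain ∧ parameter ideals tightly closed).
* `FRationalResolutionAdm` — INPUT: every stalk `FRatCl p` (= #3⁺'s output literally); OUTPUT: `Scheme.AdmitsDesingularization X` (Temkin Def. 2.2.6).
RESULTS. §2 `compl_regularLocus_subset_preimage_of_isBlowup` (the admissibility-composition lemma, once) and ★ `resolutionFullTr_of_admRungs :
FRationalModificationAdm → FRationalResolutionAdm → ∀ p e r, p.Prime → ResolutionFullTr p e r`; §3 ★★ `resolutionTr_of_prints_of_F_of_admRungs` (ADMISSIBLE
RESOLUTION of every integral `e`-fold over `k(X₁,…,X_r)`, `e ≥ 4`, ⟸ four prints ∧ F(4..e) ∧ #3⁺ ∧ #4⁺ — strong induction on the dimension, `TrOfResolutionFull`);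
§4 ★★★ **`fInjectiveMacaulayfication_of_prints_of_LFadmF_of_admRungs : CP11 → 081R → CP44 → Česnavičius(B) → LocalFInjectivizationFibreAdmGe4 →
FRationalModificationAdm → FRationalResolutionAdm → Theses.FrobeniusLadder.FInjectiveMacaulayfication`** — «crux #2 = the F-half + the route's own rungs #3, #4 one
dimension down, taken admissibly» in the kernel (+ `stubTr_of_prints_of_LFadmF_of_admRungs`); §5 over the ground field itself (`r = 0` along `k ≅ Frac(k[∅])`):
`admitsDesingularization_of_prints_of_F_of_admRungs` (integral, `3 ≤ dim X`; `dim X = 3` is Cossart–Piltant). HONEST LEDGER EFFECT (tri-2 (4), verbatim in spirit):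
this RE-ATTRIBUTES the T-residue to the route's rungs taken admissibly; it does not shrink it — #3⁺/#4⁺ over the imperfect fields `k(s)` are at least
resolution-hard in dimension ≥ 4. NOT covered (said plainly): REDUCED non-integral `X` in admissible currency (a Sing-supported blowing up separating components is
not in the tree) and `dim X ≤ 2` globally (the tree's admissible Cossart–Piltant export is `dim = 3`).
[folklore assembly; cite: Temkin2008, Lemma 2.1.4, Def. 2.2.6, Prop. 2.3.4] [cite: StacksProject, Tag 080B; Tag 02OS] [cite: CossartPiltant2019, Thm. 1.1 (i)(ii); Prop. 4.4]
[cite: Cesnavicius2021, Thm. 5.3] [cite: RaynaudGruson1971, Thm. 5.2.2]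
-/

-- single-problem summit: the doubled namespace component is forced
set_option linter.dupNamespace false

noncomputable section

namespace Summit.ResolutionOfSingularities.ResolutionOfSingularities.Theorems.FInjectiveMacaulayfication.AdmRungs

open CategoryTheory CategoryTheory.Limits AlgebraicGeometry TopologicalSpace IsLocalRing
open Literature.AlgebraicGeometry.Resolution Literature.AlgebraicGeometry.CossartPiltant200819
open Summit.ResolutionOfSingularities.ResolutionOfSingularities.Theorems.FInjectiveMacaulayfication
open SliceableCentre ClosedPointLocalResolutionAdmTr TrOfResolution TrOfResolutionFull

/-! ## §1 The F-rational stalk clause and the admissible rungs #3⁺, #4⁺ -/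

/-- The per-stalk F-RATIONAL clause of route items `FRationalModification` (output) / `FRationalResolution` (input) VERBATIM: `A` is a domain and every ideal
generated by a system of parameters is tightly closed (`c ≠ 0`, `c·y^(p^e) ∈ (s)^[p^e]` for all `e` ⇒ `y ∈ (s)`); reducibly the items' text. [folklore; OURS abbreviation] -/
abbrev FRatCl (p : ℕ) (A : Type) [CommRing A] : Prop :=
  IsDomain A ∧ ∀ d : ℕ, ringKrullDim A = d → ∀ s : Fin d → A, (Ideal.span (Set.range s)).radical.IsMaximal →
    ∀ y c : A, c ≠ 0 → (∀ e : ℕ, c * y ^ p ^ e ∈ Ideal.span ((fun z : A => z ^ p ^ e) '' (Ideal.span (Set.range s) : Set A))) →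
      y ∈ Ideal.span (Set.range s)

/-- [OURS · CANDIDATE statement] **#3⁺ `FRationalModificationAdm` — ADMISSIBLE F-RATIONALIFICATION OF FULL VARIETIES.** Quantifier prefix of route item
`FRationalModification` (stmt-…-15316); INPUT = every stalk of `X` FULL (`SliceableCentre.FullCl p`, crux #2's per-stalk output package verbatim); OUTPUT = ONE
blowing up `X′ → X` along `J ≠ ⊥` with `Supp J ⊆ (Reg X)ᶜ` all of whose stalks are F-rational (`FRatCl p`). STRONGER than the item (which asks for a weak proper
birational model and allows a weak FULL model as input); consumed only as a hypothesis. [candidate statement, OURS; cite: Temkin2008, Def. 2.2.6] -/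
@[conjecture] def FRationalModificationAdm : Prop :=
  ∀ p : ℕ, p.Prime → ∀ (k : Type) [Field k] [CharP k p] (X : Scheme.{0}) (f : X ⟶ Spec (.of k)),
    IsSeparated f → LocallyOfFiniteType f → QuasiCompact f → IsReduced X →
    (∀ x : X, FullCl p (X.presheaf.stalk x)) →
    ∃ (X' : Scheme.{0}) (π : X' ⟶ X) (J : X.IdealSheafData), IsBlowup π J ∧ J ≠ ⊥ ∧
      (J.support : Set X) ⊆ (Scheme.regularLocus X)ᶜ ∧ ∀ x' : X', FRatCl p (X'.presheaf.stalk x')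

/-- [OURS · CANDIDATE statement] **#4⁺ `FRationalResolutionAdm` — ADMISSIBLE RESOLUTION OF F-RATIONAL VARIETIES.** Quantifier prefix of route item
`FRationalResolution` (stmt-…-15317); INPUT = every stalk F-rational (`FRatCl p`, #3⁺'s output literally); OUTPUT = `Scheme.AdmitsDesingularization X` (ONE blowing
up with centre in `Sing X` and regular source, Temkin Def. 2.2.6) — STRONGER than the item's weak `HasResolution`; consumed only as a hypothesis.
[candidate statement, OURS; cite: Temkin2008, Def. 2.2.6] -/
@[conjecture] def FRationalResolutionAdm : Prop :=
  ∀ p : ℕ, p.Prime → ∀ (k : Type) [Field k] [CharP k p] (X : Scheme.{0}) (f : X ⟶ Spec (.of k)),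
    IsSeparated f → LocallyOfFiniteType f → QuasiCompact f → IsReduced X →
    (∀ x : X, FRatCl p (X.presheaf.stalk x)) → Scheme.AdmitsDesingularization X

/-! ## §2 Admissibility composes; `ResolutionFullTr` from the admissible rungs -/

/-- **The admissibility-composition lemma** (res-L1-w45a-tri-2 condition (3), made explicit once): if `π : X′ → X` is a blowing up along `J` with `Supp J ⊆ Sing X`,
then `Sing X′ ⊆ π⁻¹(Sing X)` — `π` is an isomorphism off `Supp J` (`IsBlowup.isIso_compl`), so a point of `X′` over `Reg X` is regular. This is what lets a
second `Sing X′`-supported centre count as `Sing X`-supported in `IsBlowup.exists_isBlowup_comp_supported`, and what a WEAK model cannot offer.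
[folklore; cite: StacksProject, Tag 02OS] -/
theorem compl_regularLocus_subset_preimage_of_isBlowup {X' X : Scheme.{0}} {π : X' ⟶ X} {J : X.IdealSheafData} (hπ : IsBlowup π J)
    (hJ : (J.support : Set X) ⊆ (Scheme.regularLocus X)ᶜ) : (Scheme.regularLocus X')ᶜ ⊆ π ⁻¹' (Scheme.regularLocus X)ᶜ := by
  intro x' hx' hreg
  have h1 : π x' ∉ (J.support : Set X) := fun h => hJ h hreg
  haveI := hπ.isIso_compl
  exact hx' ((mem_regularLocus_iff_of_isIso_morphismRestrict π ⟨(J.support : Set X)ᶜ, J.support.isClosed.isOpen_compl⟩ x' h1).mpr hreg)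

/-- ★ **`ResolutionFullTr p e r` ⟸ #3⁺ ∧ #4⁺** (every prime `p`, every `e`, every `r`): F-rationalify the FULL `e`-fold `Y` over `K = k(X₁,…,X_r)` by ONE `Sing Y`-supported
blowing up `Y′ → Y` (#3⁺ at the field `K`), desingularize the F-rational `Y′` (#4⁺ at `K`; `Y′` is again an integral separated finite-type `K`-scheme), compose by
Temkin 2.1.4 / Stacks 080B. [folklore assembly; cite: Temkin2008, Lemma 2.1.4] [cite: StacksProject, Tag 080B] -/
theorem resolutionFullTr_of_admRungs (h3 : FRationalModificationAdm) (h4 : FRationalResolutionAdm) :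
    ∀ p e r : ℕ, p.Prime → ResolutionFullTr p e r := by
  intro p e r hp k _ _ Y g hs hl hq hi hd hfull
  haveI := hs; haveI := hl; haveI := hq
  haveI := NonClosedPointChart.charP_fractionRing_mvPolynomial p k r
  haveI : IsLocallyNoetherian Y := LocallyOfFiniteType.isLocallyNoetherian g
  haveI : CompactSpace Y := QuasiCompact.compactSpace_of_compactSpace g
  haveI : IsNoetherian Y := {}
  obtain ⟨Y', π, J, hπ, hJ, hJs, hfr⟩ := h3 p hp _ Y g hs hl hq inferInstance hfull
  haveI : IsIntegral Y' := hπ.isIntegral hJ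
  haveI : IsProper π := hπ.isProper
  obtain ⟨Y'', ρ, hdes⟩ := h4 p hp _ Y' (π ≫ g) inferInstance inferInstance inferInstance inferInstance hfr
  obtain ⟨J', hρ, hJ's⟩ := hdes.exists_isBlowup
  obtain ⟨Q, hQ, hQs⟩ := hπ.exists_isBlowup_comp_supported π J ρ J' (Scheme.regularLocus Y)ᶜ hJs hρ
    (hJ's.trans (compl_regularLocus_subset_preimage_of_isBlowup hπ hJs))
  exact ⟨Y'', ρ ≫ π, ⟨Q, hQ, hQs⟩, hdes.isRegular⟩

/-! ## §3 Admissible resolution of `e`-folds over `k(X₁,…,X_r)` from the prints, the F-half and the admissible rungs -/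

/-- ★★ **ADMISSIBLE RESOLUTION of every integral separated finite-type `e`-fold over `k(X₁,…,X_r)`, `e ≥ 4` (`r = 0`: over every field of characteristic `p`, up to
`k ≅ Frac(k[∅])`) ⟸ {CP 1.1, 081R, CP 4.4, Česnavičius (B)} ∧ the F-half at the levels `4 … e` ∧ #3⁺ ∧ #4⁺** — the route's thesis per dimension, ADMISSIBLY, by the
strong induction `TrOfResolutionFull.resolutionTr_of_cesnaviciusOffClosed_of_F_of_resolutionFull`. [OURS · conditional-result] [cite: Temkin2008, Prop. 2.3.4; Lemma 2.1.4]
[cite: CossartPiltant2019, Thm. 1.1 (i)(ii); Prop. 4.4] [cite: Cesnavicius2021, Thm. 5.3] -/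
theorem resolutionTr_of_prints_of_F_of_admRungs {e : ℕ} (h4e : 4 ≤ e)
    (hG : CossartPiltant2019General.{0}) (h081R : Stacks081R.{0}) (hP : CossartPiltant2019Principalization.{0})
    (hM : CesnaviciusBlowupMacaulayficationOffClosed.{0}) {p : ℕ} (hp : p.Prime)
    (hF : ∀ e' : ℕ, 4 ≤ e' → e' ≤ e → ∀ (k : Type) [Field k] [CharP k p] (X : Scheme.{0}) (f : X ⟶ Spec (.of k)),
      IsSeparated f → LocallyOfFiniteType f → QuasiCompact f → IsIntegral X →
      ∀ x : X, IsClosed ({x} : Set X) → x ∉ Scheme.regularLocus X → ringKrullDim (X.presheaf.stalk x) = e' →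
      ∀ (S' : Scheme.{0}) (g : S' ⟶ Spec (X.presheaf.stalk x)) (I : (Spec (X.presheaf.stalk x)).IdealSheafData),
        I ≠ ⊥ → (I.support : Set (Spec (X.presheaf.stalk x))) ⊆ (Scheme.regularLocus (Spec (X.presheaf.stalk x)))ᶜ → IsBlowup g I →
        (∀ s : S', g.base s ≠ closedPoint (X.presheaf.stalk x) → s ∈ Scheme.regularLocus S') →
        (∀ s : S', CMCl (S'.presheaf.stalk s)) →
        ∃ 𝓚 : S'.IdealSheafData, 𝓚 ≠ ⊥ ∧ (∀ s ∈ (𝓚.support : Set S'), g.base s = closedPoint (X.presheaf.stalk x)) ∧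
          ∀ (S'' : Scheme.{0}) (π : S'' ⟶ S'), IsBlowup π 𝓚 → ∀ s : S'', FullCl p (S''.presheaf.stalk s))
    (h3 : FRationalModificationAdm) (h4 : FRationalResolutionAdm) (r : ℕ) : ResolutionTr p e r :=
  resolutionTr_of_cesnaviciusOffClosed_of_F_of_resolutionFull h4e hG h081R hP hM hp hF
    (fun e' _ _ => resolutionFullTr_of_admRungs h3 h4 p e' 1 hp) (resolutionFullTr_of_admRungs h3 h4 p e r hp)

/-! ## §4 The door terms: crux #2 = the F-half + the route's rungs #3, #4 one dimension down, taken admissibly -/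

/-- ★★ **Door v38's resolution stub ⟸ four prints ∧ the F-half ∧ #3⁺ ∧ #4⁺.** [OURS · conditional-result] [cite: Temkin2008, Prop. 2.3.4] [cite: CossartPiltant2019, Thm. 1.1; Prop. 4.4]
[cite: Cesnavicius2021, Thm. 5.3] -/
theorem stubTr_of_prints_of_LFadmF_of_admRungs
    (hG : CossartPiltant2019General.{0}) (h081R : Stacks081R.{0}) (hP : CossartPiltant2019Principalization.{0})
    (hM : CesnaviciusBlowupMacaulayficationOffClosed.{0})
    (hLF : LocalFullificationFibreAdmGe4Split.LocalFInjectivizationFibreAdmGe4)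
    (h3 : FRationalModificationAdm) (h4 : FRationalResolutionAdm) :
    ∀ p e r : ℕ, p.Prime → 4 ≤ e → 1 ≤ r → ClosedPointLocalResolutionAdmTr p e r :=
  stubTr_of_cesnaviciusOffClosed_of_LFadmF_of_resolutionFull hG h081R hP hM hLF fun p e r hp _ _ => resolutionFullTr_of_admRungs h3 h4 p e r hp

/-- ★★★ **THE ROUTE DECL ⟸ {CP 2019 Thm 1.1, Stacks 081R, CP 2019 Prop 4.4, Česnavičius 2021 Thm 5.3 (B)} BY NAME ∧ the F-half `LocalFInjectivizationFibreAdmGe4` ∧ the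
route's OWN rungs one dimension down TAKEN ADMISSIBLY (`FRationalModificationAdm`, `FRationalResolutionAdm`)** — res-L1-w45a-plan-1's ROUTE-INDUCTION READING (R18.3) in
the kernel; the WEAK items #3/#4 as typed do NOT suffice (module docstring). [OURS · conditional-result: conditional on four published theorems BY NAME and on three
CANDIDATE statements] [cite: Cesnavicius2021, Thm. 5.3] [cite: CossartPiltant2019, Thm. 1.1 (i)(ii); Prop. 4.4] [cite: RaynaudGruson1971, Thm. 5.2.2] [cite: Temkin2008, Prop. 2.3.4] -/
theorem fInjectiveMacaulayfication_of_prints_of_LFadmF_of_admRungs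
    (hG : CossartPiltant2019General.{0}) (h081R : Stacks081R.{0}) (hP : CossartPiltant2019Principalization.{0})
    (hM : CesnaviciusBlowupMacaulayficationOffClosed.{0})
    (hLF : LocalFullificationFibreAdmGe4Split.LocalFInjectivizationFibreAdmGe4)
    (h3 : FRationalModificationAdm) (h4 : FRationalResolutionAdm) :
    Summit.ResolutionOfSingularities.ResolutionOfSingularities.Theses.FrobeniusLadder.FInjectiveMacaulayfication :=
  fInjectiveMacaulayfication_of_cesnaviciusOffClosed_of_LFadmF_of_resolutionFull hG h081R hP hM hLF
    fun p e r hp _ _ => resolutionFullTr_of_admRungs h3 h4 p e r hp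

/-! ## §5 Over the ground field itself: `r = 0` along `k ≅ Frac(k[∅])` -/

/-- `k ≅ Frac(k[X_i : i ∈ ∅])`: the polynomial ring in no variables is `k` (`MvPolynomial.isEmptyAlgEquiv`), a field, so it is its own fraction ring
(`IsLocalization.atUnits`). [folklore] -/
theorem nonempty_ringEquiv_fractionRing_fin_zero (k : Type) [Field k] :
    Nonempty (k ≃+* FractionRing (MvPolynomial (Fin 0) k)) := by
  let e₁ : MvPolynomial (Fin 0) k ≃ₐ[k] k := MvPolynomial.isEmptyAlgEquiv k (Fin 0)
  have H : nonZeroDivisors (MvPolynomial (Fin 0) k) ≤ IsUnit.submonoid (MvPolynomial (Fin 0) k) := by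
    intro x hx
    have hx0 : x ≠ 0 := nonZeroDivisors.ne_zero hx
    have h1 : e₁ x ≠ 0 := fun h => hx0 (by simpa using congrArg e₁.symm h)
    have h2 : IsUnit (e₁ x) := isUnit_iff_ne_zero.mpr h1
    show x ∈ IsUnit.submonoid (MvPolynomial (Fin 0) k)
    rw [IsUnit.mem_submonoid_iff]
    simpa using h2.map e₁.symm
  exact ⟨e₁.symm.toRingEquiv.trans
    (IsLocalization.atUnits (MvPolynomial (Fin 0) k) (nonZeroDivisors (MvPolynomial (Fin 0) k))
      (S := FractionRing (MvPolynomial (Fin 0) k)) H).toRingEquiv⟩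

/-- ★★ **ADMISSIBLE RESOLUTION OF EVERY INTEGRAL VARIETY OF DIMENSION `e ≥ 4` over every field of characteristic `p` ⟸ four prints ∧ F(4..e) ∧ #3⁺ ∧ #4⁺** (`r = 0` of §3
read over `k` itself along `k ≅ Frac(k[∅])`). [OURS · conditional-result] [cite: Temkin2008, Prop. 2.3.4; Lemma 2.1.4] [cite: CossartPiltant2019, Thm. 1.1; Prop. 4.4]
[cite: Cesnavicius2021, Thm. 5.3] -/
theorem admitsDesingularization_of_prints_of_F_of_admRungs {e : ℕ} (h4e : 4 ≤ e)
    (hG : CossartPiltant2019General.{0}) (h081R : Stacks081R.{0}) (hP : CossartPiltant2019Principalization.{0})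
    (hM : CesnaviciusBlowupMacaulayficationOffClosed.{0}) {p : ℕ} (hp : p.Prime)
    (hF : ∀ e' : ℕ, 4 ≤ e' → e' ≤ e → ∀ (k : Type) [Field k] [CharP k p] (X : Scheme.{0}) (f : X ⟶ Spec (.of k)),
      IsSeparated f → LocallyOfFiniteType f → QuasiCompact f → IsIntegral X →
      ∀ x : X, IsClosed ({x} : Set X) → x ∉ Scheme.regularLocus X → ringKrullDim (X.presheaf.stalk x) = e' →
      ∀ (S' : Scheme.{0}) (g : S' ⟶ Spec (X.presheaf.stalk x)) (I : (Spec (X.presheaf.stalk x)).IdealSheafData),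
        I ≠ ⊥ → (I.support : Set (Spec (X.presheaf.stalk x))) ⊆ (Scheme.regularLocus (Spec (X.presheaf.stalk x)))ᶜ → IsBlowup g I →
        (∀ s : S', g.base s ≠ closedPoint (X.presheaf.stalk x) → s ∈ Scheme.regularLocus S') →
        (∀ s : S', CMCl (S'.presheaf.stalk s)) →
        ∃ 𝓚 : S'.IdealSheafData, 𝓚 ≠ ⊥ ∧ (∀ s ∈ (𝓚.support : Set S'), g.base s = closedPoint (X.presheaf.stalk x)) ∧
          ∀ (S'' : Scheme.{0}) (π : S'' ⟶ S'), IsBlowup π 𝓚 → ∀ s : S'', FullCl p (S''.presheaf.stalk s))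
    (h3 : FRationalModificationAdm) (h4 : FRationalResolutionAdm)
    (k : Type) [Field k] [CharP k p] (X : Scheme.{0}) (f : X ⟶ Spec (.of k))
    [IsSeparated f] [LocallyOfFiniteType f] [QuasiCompact f] [IsIntegral X] (hd : topologicalKrullDim X = e) :
    Scheme.AdmitsDesingularization X := by
  obtain ⟨φ⟩ := nonempty_ringEquiv_fractionRing_fin_zero k
  let ι : Spec (.of k) ⟶ Spec (.of (FractionRing (MvPolynomial (Fin 0) k))) := Spec.map φ.symm.toCommRingCatIso.hom
  haveI : IsIso ι := inferInstance
  exact resolutionTr_of_prints_of_F_of_admRungs h4e hG h081R hP hM hp hF h3 h4 0 k X (f ≫ ι)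
    inferInstance inferInstance inferInstance inferInstance hd

/-- **Dimension exactly `3`: admissible resolution is Cossart–Piltant outright** (the tree's one-blow-up export; no F-half, no rungs). [OURS · conditional-result]
[cite: CossartPiltant2019, Thm. 1.1 (i)(ii); Prop. 4.4] [cite: RaynaudGruson1971, Thm. 5.2.2] -/
theorem admitsDesingularization_of_prints_dimThree
    (hG : CossartPiltant2019General.{0}) (h081R : Stacks081R.{0}) (hP : CossartPiltant2019Principalization.{0})
    {k : Type} [Field k] {X : Scheme.{0}} (f : X ⟶ Spec (.of k))
    [IsSeparated f] [LocallyOfFiniteType f] [QuasiCompact f] [IsIntegral X] (hd : topologicalKrullDim X = 3) :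
    Scheme.AdmitsDesingularization X := by
  haveI : IsLocallyNoetherian X := LocallyOfFiniteType.isLocallyNoetherian f
  haveI : CompactSpace X := QuasiCompact.compactSpace_of_compactSpace f
  haveI : IsNoetherian X := {}
  haveI : X.IsSeparated := Scheme.isSeparated_of_isSeparated_over f
  have hqe : Scheme.IsQuasiExcellent X := Scheme.isQuasiExcellent_of_locallyOfFiniteType Stacks07QW_field_holds f
  obtain ⟨𝓛, T, ρ, -, hρ, hTreg, U, hU, h𝓛U, -⟩ := CP2019.exists_isBlowup_isRegular_of_dim_three_of_isQuasiExcellent hG h081R hP hqe hd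
  refine ⟨T, ρ, ⟨⟨𝓛, hρ, ?_⟩, hTreg⟩⟩
  rw [← hU]
  exact h𝓛U

/-- ★★ **ADMISSIBLE RESOLUTION OF EVERY INTEGRAL VARIETY OF DIMENSION `3 ≤ dim X ≤ d` over every field of characteristic `p` ⟸ four prints ∧ F(4..d) ∧ #3⁺ ∧ #4⁺**
(res-L1-w45a-plan-1's O2″ shape, integral form; dimension ≤ 2 and reduced non-integral `X` are NOT covered — module docstring). [OURS · conditional-result]
[cite: Temkin2008, Prop. 2.3.4; Lemma 2.1.4] [cite: CossartPiltant2019, Thm. 1.1 (i)(ii); Prop. 4.4] [cite: Cesnavicius2021, Thm. 5.3] -/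
theorem admitsDesingularization_dimLe_of_prints_of_F_of_admRungs (d : ℕ)
    (hG : CossartPiltant2019General.{0}) (h081R : Stacks081R.{0}) (hP : CossartPiltant2019Principalization.{0})
    (hM : CesnaviciusBlowupMacaulayficationOffClosed.{0}) {p : ℕ} (hp : p.Prime)
    (hF : ∀ e' : ℕ, 4 ≤ e' → e' ≤ d → ∀ (k : Type) [Field k] [CharP k p] (X : Scheme.{0}) (f : X ⟶ Spec (.of k)),
      IsSeparated f → LocallyOfFiniteType f → QuasiCompact f → IsIntegral X →
      ∀ x : X, IsClosed ({x} : Set X) → x ∉ Scheme.regularLocus X → ringKrullDim (X.presheaf.stalk x) = e' →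
      ∀ (S' : Scheme.{0}) (g : S' ⟶ Spec (X.presheaf.stalk x)) (I : (Spec (X.presheaf.stalk x)).IdealSheafData),
        I ≠ ⊥ → (I.support : Set (Spec (X.presheaf.stalk x))) ⊆ (Scheme.regularLocus (Spec (X.presheaf.stalk x)))ᶜ → IsBlowup g I →
        (∀ s : S', g.base s ≠ closedPoint (X.presheaf.stalk x) → s ∈ Scheme.regularLocus S') →
        (∀ s : S', CMCl (S'.presheaf.stalk s)) →
        ∃ 𝓚 : S'.IdealSheafData, 𝓚 ≠ ⊥ ∧ (∀ s ∈ (𝓚.support : Set S'), g.base s = closedPoint (X.presheaf.stalk x)) ∧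
          ∀ (S'' : Scheme.{0}) (π : S'' ⟶ S'), IsBlowup π 𝓚 → ∀ s : S'', FullCl p (S''.presheaf.stalk s))
    (h3 : FRationalModificationAdm) (h4 : FRationalResolutionAdm)
    (k : Type) [Field k] [CharP k p] (X : Scheme.{0}) (f : X ⟶ Spec (.of k))
    [IsSeparated f] [LocallyOfFiniteType f] [QuasiCompact f] [IsIntegral X]
    (h3d : (3 : WithBot ℕ∞) ≤ topologicalKrullDim X) (hXd : topologicalKrullDim X ≤ d) :
    Scheme.AdmitsDesingularization X := by
  haveI : CompactSpace X := QuasiCompact.compactSpace_of_compactSpace f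
  obtain ⟨n₀, hn₀⟩ := exists_topologicalKrullDim_le_of_locallyOfFiniteType f
  obtain ⟨n, hn⟩ := exists_topologicalKrullDim_eq_nat hn₀
  have h3n : 3 ≤ n := by rw [hn] at h3d; exact_mod_cast h3d
  have hnd : n ≤ d := by rw [hn] at hXd; exact_mod_cast hXd
  rcases Nat.lt_or_ge n 4 with hlt | h4n
  · have h3 : n = 3 := by omega
    subst h3
    exact admitsDesingularization_of_prints_dimThree hG h081R hP f hn
  · exact admitsDesingularization_of_prints_of_F_of_admRungs h4n hG h081R hP hM hp (fun e' h4' he' => hF e' h4' (he'.trans hnd)) h3 h4 k X f hn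

end Summit.ResolutionOfSingularities.ResolutionOfSingularities.Theorems.FInjectiveMacaulayfication.AdmRungs

end
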